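import Mathlib.NumberTheory.SmoothNumbers
import Mathlib.NumberTheory.ArithmeticFunction.VonMangoldt
import Mathlib.Algebra.Order.Floor.Semifield
import Mathlib.Data.Nat.Prime.Int
import Mathlib.NumberTheory.PrimeCounting
import Mathlib.Analysis.SpecialFunctions.Exp
import HarnessLib

/-!
# Hildebrand's identity `Ψ(x, y) log x = Σ_{n ∈ S(x,y)} log(x/n) + Σ_{d ∈ S(x,y)} Λ(d) Ψ(x/d, y)`

Topic `Literature/NumberTheory/Sieve`; a PROVED tool file toward `Literature.NumberTheory.Sieve.HTLocalBehaviour`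
(Hildebrand–Tenenbaum 1986, Theorem 3) in the range of small `u`, where Theorem 1 of that paper rests on
de Bruijn's asymptotic `Ψ(x, y) ∼ xρ(u)` proved by Hildebrand's functional-equation method. Its starting point
is the elementary identity [Hildebrand1986, (2)] `Ψ(x,y) log x = ∫₁^x Ψ(t,y) dt/t + Σ_{p^m ≤ x, p ≤ y} Ψ(x/p^m,y) log p`,
obtained (op. cit. §3) by evaluating `Σ_{n ∈ S(x, y)} log n` in two ways (`log n = Σ_{d ∣ n} Λ(d)`, and
`log n = log x - log(x/n)`); here `S(x, y)` is the set of `y`-friable `1 ≤ n ≤ x`, `Ψ(x, y) = #S(x, y)`, and we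
keep the logarithmic term as the finite sum `Σ_{n ∈ S(x,y)} log(x/n)` (`= ∫₁^x Ψ(t,y) dt/t`), which we only
bound from above:

* `sum_log_eq_sum_vonMangoldt_mul_card` — `Σ_{n ∈ S(x,y)} log n = Σ_{d ∈ S(x,y)} Λ(d) Ψ(x/d, y)`;
* `card_mul_log_eq` — **the identity** `Ψ(x,y) log x = Σ_{n ∈ S(x,y)} log(x/n) + Σ_{d ∈ S(x,y)} Λ(d) Ψ(x/d, y)`;
* `sum_log_div_le` — `0 ≤ Σ_{n ∈ S(x,y)} log(x/n) ≤ Ψ(x, y) + Σ_{1 ≤ k ≤ log x} Ψ(x/e^k, y)`;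
* `sum_primesLE_le_sum_vonMangoldt`, `sum_vonMangoldt_le` — the `Λ`-sum lies between
  `Σ_{p ≤ y} log p Ψ(x/p, y)` and `Σ_{p ≤ y} log p Ψ(x/p, y) + Σ_{p ≤ y} Σ_{2 ≤ m ≤ log x/log 2} log p Ψ(x/p^m, y)`.

## References

* [Hildebrand1986] A. Hildebrand, *On the number of positive integers ≤ x and free of prime factors > y*,
  J. Number Theory 22 (1986) 289–307, identity (2) and its proof in §3 (held:
  `paper:doi-10-1016-0022-314x-86-90013-2`, pp. 292, 298–299).
* [HildebrandTenenbaum1986] A. Hildebrand, G. Tenenbaum, Trans. AMS 296 (1986) 265–290, §1 (1.5)–(1.7).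
-/

noncomputable section

open Finset Real ArithmeticFunction

namespace Literature.NumberTheory.Sieve

namespace HildebrandIdentity

variable {x : ℝ} {y : ℕ}

/-! ### The finite sets `S(x, y) = Nat.smoothNumbersUpTo ⌊x⌋ (y+1)` -/

/-- Members of `S(x, y)` are positive. [folklore] -/
theorem pos_of_mem {n : ℕ} (hn : n ∈ Nat.smoothNumbersUpTo ⌊x⌋₊ (y + 1)) : 0 < n :=
  Nat.pos_of_ne_zero (Nat.mem_smoothNumbersUpTo.1 hn).2.1

/-- Members of `S(x, y)` are at most `x` (for `x ≥ 0`). [folklore] -/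
theorem le_of_mem {n : ℕ} (hx : 0 ≤ x) (hn : n ∈ Nat.smoothNumbersUpTo ⌊x⌋₊ (y + 1)) : (n : ℝ) ≤ x :=
  le_trans (by exact_mod_cast (Nat.mem_smoothNumbersUpTo.1 hn).1) (Nat.floor_le hx)

/-- `S(z, y) = ∅` for `z < 1`. [folklore] -/
theorem eq_empty_of_lt_one {z : ℝ} (hz : z < 1) : Nat.smoothNumbersUpTo ⌊z⌋₊ (y + 1) = ∅ := by
  ext n
  simp only [Nat.mem_smoothNumbersUpTo, Finset.notMem_empty, iff_false, not_and]
  intro hn hs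
  have h0 : ⌊z⌋₊ = 0 := Nat.floor_eq_zero.2 hz
  rw [h0, Nat.le_zero] at hn
  exact hs.1 hn

/-- A divisor of a member of `S(x, y)` is a member. [folklore] -/
theorem mem_of_dvd {n d : ℕ} (hn : n ∈ Nat.smoothNumbersUpTo ⌊x⌋₊ (y + 1)) (hd : d ∣ n) :
    d ∈ Nat.smoothNumbersUpTo ⌊x⌋₊ (y + 1) := by
  rw [Nat.mem_smoothNumbersUpTo] at hn ⊢
  exact ⟨le_trans (Nat.le_of_dvd (Nat.pos_of_ne_zero hn.2.1) hd) hn.1, Nat.mem_smoothNumbers_of_dvd hn.2 hd⟩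

/-- `{n ∈ S(x, y) : n ≤ z} = S(z, y)` for `z ≤ x`. [folklore] -/
theorem filter_le_eq {z : ℝ} (hz : z ≤ x) :
    (Nat.smoothNumbersUpTo ⌊x⌋₊ (y + 1)).filter (fun n : ℕ => (n : ℝ) ≤ z) = Nat.smoothNumbersUpTo ⌊z⌋₊ (y + 1) := by
  ext n
  simp only [Finset.mem_filter, Nat.mem_smoothNumbersUpTo]
  constructor
  · rintro ⟨⟨-, hs⟩, hnz⟩
    have hn0 : (1 : ℝ) ≤ n := by exact_mod_cast Nat.pos_of_ne_zero hs.1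
    exact ⟨Nat.le_floor hnz, hs⟩
  · rintro ⟨hnz, hs⟩
    have hn1 : 1 ≤ n := Nat.pos_of_ne_zero hs.1
    have hz0 : 0 ≤ z := by
      by_contra h
      push Not at h
      rw [Nat.floor_eq_zero.2 (by linarith), Nat.le_zero] at hnz
      exact hs.1 hnz
    exact ⟨⟨hnz.trans (Nat.floor_mono hz), hs⟩, (Nat.le_floor_iff hz0).1 hnz⟩

/-- The multiples of a friable `d` in `S(x, y)` are the `d·k`, `k ∈ S(x/d, y)`. [folklore] -/
theorem filter_dvd_eq_image {d : ℕ} (hd : d ∈ Nat.smoothNumbers (y + 1)) :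
    (Nat.smoothNumbersUpTo ⌊x⌋₊ (y + 1)).filter (fun n => d ∣ n) =
      (Nat.smoothNumbersUpTo ⌊x / d⌋₊ (y + 1)).image (fun k => d * k) := by
  have hd0 : 0 < d := Nat.pos_of_ne_zero hd.1
  ext n
  simp only [Finset.mem_filter, Finset.mem_image, Nat.mem_smoothNumbersUpTo, Nat.floor_div_natCast]
  constructor
  · rintro ⟨⟨hn, hs⟩, ⟨k, rfl⟩⟩
    refine ⟨k, ⟨?_, Nat.mem_smoothNumbers_of_dvd hs (Dvd.intro_left d rfl)⟩, rfl⟩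
    rw [Nat.le_div_iff_mul_le hd0, mul_comm]
    exact hn
  · rintro ⟨k, ⟨hk, hks⟩, rfl⟩
    refine ⟨⟨?_, Nat.mul_mem_smoothNumbers hd hks⟩, Dvd.intro k rfl⟩
    rw [Nat.le_div_iff_mul_le hd0, mul_comm] at hk
    exact hk

/-- `#{n ∈ S(x, y) : d ∣ n} = Ψ(x/d, y)` for friable `d`. [folklore] -/
theorem card_filter_dvd {d : ℕ} (hd : d ∈ Nat.smoothNumbers (y + 1)) :
    ((Nat.smoothNumbersUpTo ⌊x⌋₊ (y + 1)).filter (fun n => d ∣ n)).card =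
      (Nat.smoothNumbersUpTo ⌊x / d⌋₊ (y + 1)).card := by
  rw [filter_dvd_eq_image hd, Finset.card_image_of_injective]
  exact mul_right_injective₀ hd.1

/-! ### The identity -/

/-- `Σ_{n ∈ S(x,y)} log n = Σ_{d ∈ S(x,y)} Λ(d) Ψ(x/d, y)` (`log n = Σ_{d ∣ n} Λ(d)` and a swap of
summations). [cite: Hildebrand1986, §3, proof of (2)] -/
theorem sum_log_eq_sum_vonMangoldt_mul_card :
    ∑ n ∈ Nat.smoothNumbersUpTo ⌊x⌋₊ (y + 1), Real.log n =
      ∑ d ∈ Nat.smoothNumbersUpTo ⌊x⌋₊ (y + 1), Λ d * ((Nat.smoothNumbersUpTo ⌊x / d⌋₊ (y + 1)).card : ℝ) := by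
  calc ∑ n ∈ Nat.smoothNumbersUpTo ⌊x⌋₊ (y + 1), Real.log n
      = ∑ n ∈ Nat.smoothNumbersUpTo ⌊x⌋₊ (y + 1), ∑ d ∈ n.divisors, Λ d := by
        refine Finset.sum_congr rfl fun n _ => ?_
        rw [vonMangoldt_sum]
    _ = ∑ d ∈ Nat.smoothNumbersUpTo ⌊x⌋₊ (y + 1),
          ∑ _n ∈ (Nat.smoothNumbersUpTo ⌊x⌋₊ (y + 1)).filter (fun n => d ∣ n), Λ d := by
        refine Finset.sum_comm' fun n d => ?_
        simp only [Finset.mem_filter, Nat.mem_divisors]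
        constructor
        · rintro ⟨hn, hdn, -⟩
          exact ⟨⟨hn, hdn⟩, mem_of_dvd hn hdn⟩
        · rintro ⟨⟨hn, hdn⟩, -⟩
          exact ⟨hn, hdn, (Nat.mem_smoothNumbersUpTo.1 hn).2.1⟩
    _ = _ := by
        refine Finset.sum_congr rfl fun d hd => ?_
        rw [Finset.sum_const, nsmul_eq_mul, mul_comm, card_filter_dvd (Nat.mem_smoothNumbersUpTo.1 hd).2]

/-- **Hildebrand's identity** `Ψ(x, y) log x = Σ_{n ∈ S(x,y)} log(x/n) + Σ_{d ∈ S(x,y)} Λ(d) Ψ(x/d, y)`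
(`x ≥ 1`; the finite-sum form of [Hildebrand1986, (2)]). [cite: Hildebrand1986, §1 (2) and §3] -/
theorem card_mul_log_eq (hx : 1 ≤ x) :
    ((Nat.smoothNumbersUpTo ⌊x⌋₊ (y + 1)).card : ℝ) * Real.log x =
      ∑ n ∈ Nat.smoothNumbersUpTo ⌊x⌋₊ (y + 1), Real.log (x / n) +
        ∑ d ∈ Nat.smoothNumbersUpTo ⌊x⌋₊ (y + 1), Λ d * ((Nat.smoothNumbersUpTo ⌊x / d⌋₊ (y + 1)).card : ℝ) := by
  rw [← sum_log_eq_sum_vonMangoldt_mul_card, ← Finset.sum_add_distrib]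
  rw [show ((Nat.smoothNumbersUpTo ⌊x⌋₊ (y + 1)).card : ℝ) * Real.log x =
      ∑ _n ∈ Nat.smoothNumbersUpTo ⌊x⌋₊ (y + 1), Real.log x by rw [Finset.sum_const, nsmul_eq_mul]]
  refine Finset.sum_congr rfl fun n hn => ?_
  have hn0 : (n : ℝ) ≠ 0 := by exact_mod_cast (pos_of_mem hn).ne'
  rw [Real.log_div (by linarith) hn0]
  ring

/-! ### The logarithmic term -/

/-- `0 ≤ Σ_{n ∈ S(x,y)} log(x/n)`. [folklore] -/
theorem sum_log_div_nonneg (hx : 0 ≤ x) :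
    0 ≤ ∑ n ∈ Nat.smoothNumbersUpTo ⌊x⌋₊ (y + 1), Real.log (x / n) := by
  refine Finset.sum_nonneg fun n hn => Real.log_nonneg ?_
  rw [le_div_iff₀ (by exact_mod_cast pos_of_mem hn), one_mul]
  exact le_of_mem hx hn

/-- `Σ_{n ∈ S(x,y)} log(x/n) ≤ Ψ(x, y) + Σ_{1 ≤ k ≤ log x} Ψ(x/e^k, y)` (`log(x/n) ≤ 1 + #{k ≥ 1 : e^k ≤ x/n}`
and a swap of summations). [folklore] -/
theorem sum_log_div_le (hx : 1 ≤ x) :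
    ∑ n ∈ Nat.smoothNumbersUpTo ⌊x⌋₊ (y + 1), Real.log (x / n) ≤
      ((Nat.smoothNumbersUpTo ⌊x⌋₊ (y + 1)).card : ℝ) +
        ∑ k ∈ Finset.Icc 1 ⌊Real.log x⌋₊, ((Nat.smoothNumbersUpTo ⌊x / Real.exp k⌋₊ (y + 1)).card : ℝ) := by
  set S := Nat.smoothNumbersUpTo ⌊x⌋₊ (y + 1) with hS
  set K := ⌊Real.log x⌋₊ with hK
  -- pointwise: `log(x/n) ≤ 1 + #{k ∈ [1, K] : e^k ≤ x/n}`
  have hpt : ∀ n ∈ S, Real.log (x / n) ≤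
      1 + ∑ k ∈ Finset.Icc 1 K, (if Real.exp k ≤ x / n then (1 : ℝ) else 0) := by
    intro n hn
    have hn0 : (0 : ℝ) < n := by exact_mod_cast pos_of_mem hn
    have hn1 : (1 : ℝ) ≤ n := by exact_mod_cast pos_of_mem hn
    have hxn : Real.log (x / n) ≤ Real.log x :=
      Real.log_le_log (div_pos (by linarith) hn0) (div_le_self (by linarith) hn1)
    have hsub : Finset.Icc 1 ⌊Real.log (x / n)⌋₊ ⊆ (Finset.Icc 1 K).filter (fun k : ℕ => Real.exp k ≤ x / n) := by
      intro k hk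
      rw [Finset.mem_Icc] at hk
      rw [Finset.mem_filter, Finset.mem_Icc]
      have hxn0 : 0 ≤ Real.log (x / n) :=
        Real.log_nonneg (by rw [le_div_iff₀ hn0, one_mul]; exact le_of_mem (by linarith) hn)
      have hk' : (k : ℝ) ≤ Real.log (x / n) := le_trans (by exact_mod_cast hk.2) (Nat.floor_le hxn0)
      exact ⟨⟨hk.1, le_trans hk.2 (Nat.floor_mono hxn)⟩, (Real.le_log_iff_exp_le (div_pos (by linarith) hn0)).1 hk'⟩
    have hcard : (⌊Real.log (x / n)⌋₊ : ℝ) ≤ ∑ k ∈ Finset.Icc 1 K, (if Real.exp k ≤ x / n then (1 : ℝ) else 0) := by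
      rw [← Finset.sum_filter, Finset.sum_const, nsmul_eq_mul, mul_one]
      have := Finset.card_le_card hsub
      rw [Nat.card_Icc, Nat.add_sub_cancel] at this
      exact_mod_cast this
    have hfl := Nat.lt_floor_add_one (Real.log (x / n))
    linarith
  refine (Finset.sum_le_sum hpt).trans ?_
  rw [Finset.sum_add_distrib, Finset.sum_const, nsmul_eq_mul, mul_one, Finset.sum_comm]
  refine add_le_add le_rfl (Finset.sum_le_sum fun k hk => ?_)
  rw [← Finset.sum_filter, Finset.sum_const, nsmul_eq_mul, mul_one]
  have hfilt : S.filter (fun n : ℕ => Real.exp k ≤ x / n) = S.filter (fun n : ℕ => (n : ℝ) ≤ x / Real.exp k) := by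
    refine Finset.filter_congr fun n hn => ?_
    have hn0 : (0 : ℝ) < n := by exact_mod_cast pos_of_mem hn
    rw [le_div_iff₀ hn0, le_div_iff₀ (Real.exp_pos _), mul_comm]
  have hk1 : (1 : ℝ) ≤ Real.exp k := Real.one_le_exp (Nat.cast_nonneg k)
  rw [hfilt, hS, filter_le_eq (div_le_self (by linarith) hk1)]

/-! ### Primes and prime powers in the `Λ`-sum -/

/-- `Σ_{p ≤ y} log p Ψ(x/p, y) ≤ Σ_{d ∈ S(x,y)} Λ(d) Ψ(x/d, y)`. [folklore] -/
theorem sum_primesLE_le_sum_vonMangoldt (hx : 0 ≤ x) :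
    ∑ p ∈ Nat.primesLE y, Real.log p * ((Nat.smoothNumbersUpTo ⌊x / p⌋₊ (y + 1)).card : ℝ) ≤
      ∑ d ∈ Nat.smoothNumbersUpTo ⌊x⌋₊ (y + 1), Λ d * ((Nat.smoothNumbersUpTo ⌊x / d⌋₊ (y + 1)).card : ℝ) := by
  -- primes `p > x` contribute nothing
  have hzero : ∀ p ∈ Nat.primesLE y, ¬ p ≤ ⌊x⌋₊ →
      Real.log p * ((Nat.smoothNumbersUpTo ⌊x / p⌋₊ (y + 1)).card : ℝ) = 0 := by
    intro p hp hpn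
    have hpx : ⌊x⌋₊ < p := not_le.1 hpn
    have hp0 : (0 : ℝ) < p := by exact_mod_cast (Nat.mem_primesLE.1 hp).2.pos
    have : x / p < 1 := by
      rw [div_lt_one hp0]; exact (Nat.floor_lt hx).1 hpx
    rw [eq_empty_of_lt_one this, Finset.card_empty, Nat.cast_zero, mul_zero]
  rw [← Finset.sum_filter_of_ne (p := fun p => p ≤ ⌊x⌋₊) fun p hp hne => by
    by_contra h; exact hne (hzero p hp h)]
  have hsub : (Nat.primesLE y).filter (fun p => p ≤ ⌊x⌋₊) ⊆ Nat.smoothNumbersUpTo ⌊x⌋₊ (y + 1) := by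
    intro p hp
    rw [Finset.mem_filter, Nat.mem_primesLE] at hp
    rw [Nat.mem_smoothNumbersUpTo]
    refine ⟨hp.2, hp.1.2.ne_zero, fun q hq => ?_⟩
    rw [Nat.primeFactorsList_prime hp.1.2, List.mem_singleton] at hq
    rw [hq]; exact Nat.lt_succ_of_le hp.1.1
  calc ∑ p ∈ (Nat.primesLE y).filter (fun p => p ≤ ⌊x⌋₊), Real.log p * ((Nat.smoothNumbersUpTo ⌊x / p⌋₊ (y + 1)).card : ℝ)
      = ∑ p ∈ (Nat.primesLE y).filter (fun p => p ≤ ⌊x⌋₊), Λ p * ((Nat.smoothNumbersUpTo ⌊x / p⌋₊ (y + 1)).card : ℝ) := by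
        refine Finset.sum_congr rfl fun p hp => ?_
        rw [Finset.mem_filter, Nat.mem_primesLE] at hp
        rw [vonMangoldt_apply_prime hp.1.2]
    _ ≤ _ := by
        refine Finset.sum_le_sum_of_subset_of_nonneg hsub fun d _ _ => ?_
        exact mul_nonneg vonMangoldt_nonneg (Nat.cast_nonneg _)

/-- `Σ_{d ∈ S(x,y)} Λ(d) Ψ(x/d, y) ≤ Σ_{p ≤ y} log p Ψ(x/p, y) + Σ_{p ≤ y} Σ_{2 ≤ m ≤ log x/log 2} log p Ψ(x/p^m, y)`
(`Λ` lives on prime powers `p^m ≤ x`, `p ≤ y`). [folklore] -/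
theorem sum_vonMangoldt_le (hx : 1 ≤ x) :
    ∑ d ∈ Nat.smoothNumbersUpTo ⌊x⌋₊ (y + 1), Λ d * ((Nat.smoothNumbersUpTo ⌊x / d⌋₊ (y + 1)).card : ℝ) ≤
      ∑ p ∈ Nat.primesLE y, Real.log p * ((Nat.smoothNumbersUpTo ⌊x / p⌋₊ (y + 1)).card : ℝ) +
        ∑ p ∈ Nat.primesLE y, ∑ m ∈ Finset.Icc 2 ⌊Real.log x / Real.log 2⌋₊,
          Real.log p * ((Nat.smoothNumbersUpTo ⌊x / (p : ℝ) ^ m⌋₊ (y + 1)).card : ℝ) := by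
  set S := Nat.smoothNumbersUpTo ⌊x⌋₊ (y + 1) with hS
  set M := ⌊Real.log x / Real.log 2⌋₊ with hM
  set g : ℕ → ℝ := fun d => Λ d * ((Nat.smoothNumbersUpTo ⌊x / d⌋₊ (y + 1)).card : ℝ) with hg
  have hg0 : ∀ d, 0 ≤ g d := fun d => mul_nonneg vonMangoldt_nonneg (Nat.cast_nonneg _)
  -- only prime powers count
  have h1 : ∑ d ∈ S, g d = ∑ d ∈ S.filter IsPrimePow, g d := by
    rw [Finset.sum_filter_of_ne]
    intro d _ hne
    by_contra h
    exact hne (by rw [hg]; simp only; rw [vonMangoldt_eq_zero_iff.2 h, zero_mul])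
  -- split into primes and higher powers
  have h2 : ∑ d ∈ S.filter IsPrimePow, g d =
      ∑ d ∈ (S.filter IsPrimePow).filter Nat.Prime, g d + ∑ d ∈ (S.filter IsPrimePow).filter (fun d => ¬ d.Prime), g d :=
    (Finset.sum_filter_add_sum_filter_not _ _ _).symm
  rw [h1, h2]
  refine add_le_add ?_ ?_
  · -- primes: a subset of `primesLE y`
    have hsub : (S.filter IsPrimePow).filter Nat.Prime ⊆ Nat.primesLE y := by
      intro p hp
      simp only [Finset.mem_filter, hS, Nat.mem_smoothNumbersUpTo] at hp
      rw [Nat.mem_primesLE]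
      refine ⟨?_, hp.2⟩
      have := hp.1.1.2.2 p (by rw [Nat.primeFactorsList_prime hp.2]; exact List.mem_singleton_self _)
      omega
    calc ∑ d ∈ (S.filter IsPrimePow).filter Nat.Prime, g d
        = ∑ p ∈ (S.filter IsPrimePow).filter Nat.Prime, Real.log p * ((Nat.smoothNumbersUpTo ⌊x / p⌋₊ (y + 1)).card : ℝ) := by
          refine Finset.sum_congr rfl fun p hp => ?_
          rw [hg]; simp only
          rw [vonMangoldt_apply_prime (Finset.mem_filter.1 hp).2]
      _ ≤ _ := Finset.sum_le_sum_of_subset_of_nonneg hsub fun p _ _ =>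
          mul_nonneg (Real.log_natCast_nonneg p) (Nat.cast_nonneg _)
  · -- higher prime powers: inside the image of `(p, m) ↦ p^m`, `p ≤ y`, `2 ≤ m ≤ M`
    have hx0 : 0 < x := by linarith
    have himg : (S.filter IsPrimePow).filter (fun d => ¬ d.Prime) ⊆
        ((Nat.primesLE y) ×ˢ Finset.Icc 2 M).image (fun pm : ℕ × ℕ => pm.1 ^ pm.2) := by
      intro d hd
      simp only [Finset.mem_filter, hS, Nat.mem_smoothNumbersUpTo] at hd
      obtain ⟨⟨⟨hdx, hds⟩, hpp⟩, hnp⟩ := hd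
      obtain ⟨p, k, hp, hk, rfl⟩ := (isPrimePow_nat_iff _).1 hpp
      rw [Finset.mem_image]
      refine ⟨(p, k), ?_, rfl⟩
      rw [Finset.mem_product, Nat.mem_primesLE, Finset.mem_Icc]
      have hpy : p ≤ y := by
        have := hds.2 p ((Nat.mem_primeFactorsList (pow_ne_zero k hp.ne_zero)).2 ⟨hp, dvd_pow_self p hk.ne'⟩)
        omega
      refine ⟨⟨hpy, hp⟩, ?_, ?_⟩
      · change 2 ≤ k
        by_contra h
        have hk1 : k = 1 := by omega
        subst hk1
        exact hnp (by rw [pow_one]; exact hp)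
      · -- `p^k ≤ x` gives `k log 2 ≤ k log p ≤ log x`
        change k ≤ M
        rw [hM]
        refine Nat.le_floor ?_
        have hlog2 : 0 < Real.log 2 := Real.log_pos one_lt_two
        rw [le_div_iff₀ hlog2]
        have hpk : ((p ^ k : ℕ) : ℝ) ≤ x := le_trans (by exact_mod_cast hdx) (Nat.floor_le hx0.le)
        have hp2 : (2 : ℝ) ≤ p := by exact_mod_cast hp.two_le
        calc (k : ℝ) * Real.log 2 ≤ k * Real.log p := by gcongr
          _ = Real.log ((p : ℝ) ^ k) := by rw [Real.log_pow]
          _ ≤ Real.log x := Real.log_le_log (by positivity) (by exact_mod_cast hpk)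
    have hinj : Set.InjOn (fun pm : ℕ × ℕ => pm.1 ^ pm.2) ↑((Nat.primesLE y) ×ˢ Finset.Icc 2 M) := by
      rintro ⟨p, m⟩ hpm ⟨q, n⟩ hqn heq
      simp only [Finset.coe_product, Set.mem_prod, Finset.mem_coe, Nat.mem_primesLE, Finset.mem_Icc] at hpm hqn
      simp only at heq
      obtain ⟨h1, h2⟩ := Nat.Prime.pow_inj' hpm.1.2 hqn.1.2 (by omega) (by omega) heq
      rw [h1, h2]
    calc ∑ d ∈ (S.filter IsPrimePow).filter (fun d => ¬ d.Prime), g d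
        ≤ ∑ d ∈ ((Nat.primesLE y) ×ˢ Finset.Icc 2 M).image (fun pm : ℕ × ℕ => pm.1 ^ pm.2), g d :=
          Finset.sum_le_sum_of_subset_of_nonneg himg fun d _ _ => hg0 d
      _ = ∑ pm ∈ (Nat.primesLE y) ×ˢ Finset.Icc 2 M, g (pm.1 ^ pm.2) := Finset.sum_image hinj
      _ = ∑ p ∈ Nat.primesLE y, ∑ m ∈ Finset.Icc 2 M, g (p ^ m) := Finset.sum_product _ _ _
      _ = _ := by
          refine Finset.sum_congr rfl fun p hp => Finset.sum_congr rfl fun m hm => ?_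
          rw [Nat.mem_primesLE] at hp
          rw [Finset.mem_Icc] at hm
          rw [hg]; simp only
          rw [vonMangoldt_apply_pow (by omega), vonMangoldt_apply_prime hp.2]
          push_cast
          ring

end HildebrandIdentity

end Literature.NumberTheory.Sieve

end
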